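import Summits.HodgeConjecture.HodgeConjecture.Theorems.F0P3cStCharTSVanDijkCore        -- ★ file 1 (this seat): `vanDijkWeight_re_eq_normAbs`, `vanDijkWeight_re_pos_iff`, `vanDijkWeight_re_nonneg`, §0 one-place bookkeeping; brings ★ ShellWeight (`unitModulusChar_eq_normAbs`, `normAbs_conjLocal_apply`, `normAbs_neg`)
import Summits.HodgeConjecture.HodgeConjecture.Theorems.F0P3cStCharTSWeylDiscriminant   -- ★ (LH2-p01 g3) (R2a) `sigma_rootA_eq` (torus root relation)
import Summits.HodgeConjecture.HodgeConjecture.Theorems.F0P3cStCharTSSurjHeckeLin       -- ★ (LH6-p05) `torusEntry_relation` (the torus relations `σ(d_{2−i}) dᵢ = 1`)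
import Mathlib.Algebra.CubicDiscriminant
import Mathlib.RingTheory.Polynomial.Resultant.Basic
import HarnessLib

/-!
# F0 · P3c · line LH6 «StCharTS» — «VDW-CORE★» (file 2 of 2): THE JUNCTION of van Dijk's weight with Harish-Chandra's normalised-character weight `|D_G|^{1∕2}`:
# `√√‖u‖ = Re Δ(t)` whenever `u · det(t)² = discr(charpoly t)` [Rogawski1990, §4.9 p. 54, §12.7 L. 12.7.2 (proof) p. 193] [HarishChandra1999AdmissibleDistributions, §17]

Cell `pub/hodgecm-mathlib`, crux H413 = `stmt-HodgeConjecture-24833` (lane `--supports … --as helper`), route HCCMUnconditional; seat F0P3a-p07 (g17), desk F0P3-plan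
(g15) DEAL (c1) «VDW-CORE», integrator LH6-p01 (g3) 09:07:11Z item (iii) ∕ 09:28:50Z «=» ((A4)–(A6)).  THEOREMS ONLY (no definition ∕ instance ∕ notation ∕ named fact ∕
`sorry`); ★-only imports + Mathlib.  HONEST LABEL: HC_CM is proved only modulo the 7 printed citations (2 remaining named inputs: hLiu418 = `stmt-HodgeConjecture-24832`,
h413 = `stmt-HodgeConjecture-24833`) until rung 0 closes; count-neutral (TOR)-road plumbing for the (HCB) socket of the (S-𝔇) organ `stub_EllipticPackage` of
`Cruxes/H413/Lines/F0_P3c_StCharTSPaydown.lean`; consumer LH6-p04 (g4) «HB-ON-MC★» (which feeds the named fact «HC-BOUNDED» ★ `Rogawski1990/Ch12Sec7CharacterInputs`,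
F0P3-p01 (g21), through the ADAPTER below); it closes no organ by itself.

SETTING as in file 1 (`w ∣ v` the one place, `R = LocalRing L v`, `|·|_w`, `‖·‖ = unitModulusChar R = |·|_w` ★ `unitModulusChar_eq_normAbs`, `dᵢ = torusEntry i t`,
`a − 1 = d₀⁻¹d₁ − 1`, `b − 1 = d₀⁻¹d₂ − 1`).  MATRIX SPELLING: the matrix of `t` is `(↑t : GL (Fin 3) R).val` — the same term (`Units.val`) as the coercion
`((g.val : GL) : Matrix)` of «HC-BOUNDED» at `g := ((t : U) : Gqs L v)`.
* §0 (torus relations `σ(d_{2−i}) dᵢ = 1` = ★ `F0P3cStCharTSSurjHeckeLin.torusEntry_relation`) the cubic discriminant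
  `discr ∏(X − dᵢ) = ((d₀−d₁)(d₀−d₂)(d₁−d₂))²` (Mathlib `Cubic.prod_X_sub_C_eq` + `Polynomial.discr_of_degree_eq_three`), `discr`∕`det` of `diag(d)` and of `t`, and
  «regular ⇒ `discr` is a unit» (★ (R2a) `sigma_rootA_eq`).
* §1 the norm bookkeeping `|d₁|_w = 1`, `|d₀|_w|d₂|_w = 1`, `|d₀ − dᵢ|_w = |d₀|_w|d₀⁻¹dᵢ − 1|_w`, `|d₁ − d₂|_w = |a − 1|_w` (so `|det t|_w = 1`, `|discr|_w = (|d₀|²|a−1|²|b−1|)²`),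
  the fourth root, and the three heads: **`coe_sqrt_sqrt_unitModulusChar_eq_vanDijkWeight_re`** (the junction), **`exists_unit_mul_det_sq_eq_discr_iff`** (the HC
  antecedent is inhabited iff `t` is regular), **`norm_ofReal_vanDijkWeight_re_mul_le_of_hcBound`** (ADAPTER: an «HC-BOUNDED»-shaped bound on `C ∋ t` gives
  `‖(Re Δ(t) : ℂ) · Θ(t)‖ ≤ max B 0`; at non-regular `t`, `Δ(t) = 0`).  Sanity (p. 193): `‖α‖ = q < 1` ⇒ `|d₀||a−1|√|b−1| = q·q⁻¹·q⁻¹ = q⁻¹ = D_G(γ)`.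

## References
* [Rogawski1990] J. D. Rogawski, *Automorphic Representations of Unitary Groups in Three Variables*, Ann. of Math. Stud. 123 (1990): §1.10 p. 9; §4.9 p. 54 (`D_G`),
  (4.9.4) p. 56; §12.2 p. 173; §12.5 p. 182; §12.7 L. 12.7.2 (proof) p. 193 («`D_G(γ) = ‖α‖⁻¹` for `‖α‖ < 1`»).
* [HarishChandra1999AdmissibleDistributions] Harish-Chandra (notes by DeBacker–Sally), *Admissible Invariant Distributions on Reductive p-adic Groups*, ULS 16 (1999), §16 Thm. 16.3, §17.
* [WeilBNT1967] A. Weil, *Basic Number Theory* (1967), Ch. I §2.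
-/

set_option autoImplicit false
-- the mandated namespace has the single-problem summit's repeated segment (`HodgeConjecture.HodgeConjecture`)
set_option linter.dupNamespace false

noncomputable section

open NumberField IsDedekindDomain MeasureTheory Topology Polynomial
open scoped Matrix MatrixGroups NNReal
open Literature.NumberTheory.Rogawski1990 Literature.NumberTheory.Automorphic Literature.NumberTheory.Automorphic.UnitaryGroup
open Literature.NumberTheory.GaloisRepresentations Literature.NumberTheory.GaloisRepresentations.IsNonarchimedeanLocalField

namespace Summit.HodgeConjecture.HodgeConjecture.Cruxes.H413.F0P3cStCharTSVanDijkHC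

open F0P3cStCharTSTorusDefs F0P3cStCharTSVanDijkCore

variable (L : Type) [Field L] [NumberField L] [IsCMField L] (v : HeightOneSpectrum (𝓞 ↥(maximalRealSubfield L)))

/-! ## §0 The cubic discriminant; `discr`∕`det` of a diagonal matrix and of `t ∈ T`; regular ⇒ unit discriminant -/

omit [IsCMField L] in
/-- The `w`-component of the inverse of a unit of `R` is the inverse of the `w`-component. [cite: WeilBNT1967, Ch. I §2] -/
theorem coe_inv_apply (u : (LocalRing L v)ˣ) (w : PlacesOver L v) :
    ((u⁻¹ : (LocalRing L v)ˣ) : LocalRing L v) w = ((u : LocalRing L v) w)⁻¹ := by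
  have hprod : ((u⁻¹ : (LocalRing L v)ˣ) : LocalRing L v) w * (u : LocalRing L v) w = 1 := by
    rw [← Pi.mul_apply, Units.inv_mul, Pi.one_apply]
  exact eq_inv_of_mul_eq_one_left hprod

/-- **The discriminant of a split monic cubic**: `discr ((X − d₀)(X − d₁)(X − d₂)) = ((d₀ − d₁)(d₀ − d₂)(d₁ − d₂))²` over any non-trivial commutative ring
(Mathlib `Cubic.prod_X_sub_C_eq` + `Polynomial.discr_of_degree_eq_three`). [cite: HarishChandra1999AdmissibleDistributions, §17] -/
theorem discr_prod_X_sub_C_fin_three {R : Type*} [CommRing R] [Nontrivial R] (d : Fin 3 → R) :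
    (∏ i : Fin 3, (X - C (d i))).discr = ((d 0 - d 1) * (d 0 - d 2) * (d 1 - d 2)) ^ 2 := by
  rw [Fin.prod_univ_three, Cubic.prod_X_sub_C_eq,
    Polynomial.discr_of_degree_eq_three (Cubic.degree_of_a_ne_zero (by exact one_ne_zero)),
    Cubic.coeff_eq_a, Cubic.coeff_eq_b, Cubic.coeff_eq_c, Cubic.coeff_eq_d]
  dsimp only
  ring

/-- `discr(charpoly M) = ((d₀ − d₁)(d₀ − d₂)(d₁ − d₂))²` and `det M = d₀d₁d₂` for a `3 × 3` diagonal `M = diag(d)` (Mathlib `Matrix.charpoly_diagonal`, `Matrix.det_diagonal`).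
[cite: HarishChandra1999AdmissibleDistributions, §17] -/
theorem discr_charpoly_and_det_of_eq_diagonal {R : Type*} [CommRing R] [Nontrivial R] (M : Matrix (Fin 3) (Fin 3) R) (d : Fin 3 → R)
    (hM : M = Matrix.diagonal d) :
    M.charpoly.discr = ((d 0 - d 1) * (d 0 - d 2) * (d 1 - d 2)) ^ 2 ∧ M.det = d 0 * d 1 * d 2 := by
  subst hM
  rw [Matrix.charpoly_diagonal, discr_prod_X_sub_C_fin_three, Matrix.det_diagonal, Fin.prod_univ_three]
  exact ⟨rfl, rfl⟩

/-- **Regular diagonal elements have unit discriminant**: under the torus relations, `a − 1`, `b − 1` units ⇒ `((d₀ − d₁)(d₀ − d₂)(d₁ − d₂))²` a unit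
(`d₀ − dᵢ = −d₀(d₀⁻¹dᵢ − 1)`, `d₁ − d₂ = d₂(d₂⁻¹d₁ − 1)`, `σ(a − 1) = −(d₂d₁⁻¹)(d₂⁻¹d₁ − 1)` ★ (R2a)). [cite: Rogawski1990, §12.5 p. 182; §1.10 p. 9] -/
theorem isUnit_discr_of_relations {R : Type*} [CommRing R] (σ : R →+* R) (d : Fin 3 → Rˣ)
    (hrel : ∀ i : Fin 3, σ ((d (Fin.rev i) : Rˣ) : R) * (d i : R) = 1)
    (ha : IsUnit ((((d 0)⁻¹ * d 1 : Rˣ) : R) - 1)) (hb : IsUnit ((((d 0)⁻¹ * d 2 : Rˣ) : R) - 1)) :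
    IsUnit (((((d 0 : Rˣ) : R) - d 1) * (((d 0 : Rˣ) : R) - d 2) * (((d 1 : Rˣ) : R) - d 2)) ^ 2) := by
  have hroot : ∀ i : Fin 3, ((d 0 : Rˣ) : R) - d i = -((d 0 : R) * ((((d 0)⁻¹ * d i : Rˣ) : R) - 1)) := fun i => by
    rw [Units.val_mul, mul_sub, mul_one, ← mul_assoc, Units.mul_inv, one_mul]; ring
  have hA : σ ((((d 0)⁻¹ : Rˣ) : R) * (d 1 : R) - 1) = -((d 2 : R) * (((d 1)⁻¹ : Rˣ) : R)) * ((((d 2)⁻¹ : Rˣ) : R) * (d 1 : R) - 1) :=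
    F0P3cStCharTSWeylDiscriminant.sigma_rootA_eq σ hrel
  have e12 : ((d 1 : Rˣ) : R) - d 2 = (d 2 : R) * ((((d 2)⁻¹ : Rˣ) : R) * (d 1 : R) - 1) := by
    rw [mul_sub, mul_one, ← mul_assoc, Units.mul_inv, one_mul]
  -- `d₂⁻¹d₁ − 1` is a unit: `σ(a − 1) = −(d₂d₁⁻¹)·(d₂⁻¹d₁ − 1)` and `σ(a − 1)`, `d₂d₁⁻¹` are units
  have hA' : IsUnit ((((d 2)⁻¹ : Rˣ) : R) * (d 1 : R) - 1) := by
    have hσa : IsUnit (σ ((((d 0)⁻¹ : Rˣ) : R) * (d 1 : R) - 1)) := by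
      rw [← Units.val_mul]; exact ha.map σ
    rw [hA, neg_mul, IsUnit.neg_iff] at hσa
    exact isUnit_of_mul_isUnit_right hσa
  refine IsUnit.pow 2 (IsUnit.mul (IsUnit.mul ?_ ?_) ?_)
  · rw [hroot 1]; exact ((d 0).isUnit.mul ha).neg
  · rw [hroot 2]; exact ((d 0).isUnit.mul hb).neg
  · rw [e12]; exact (d 2).isUnit.mul hA'

/-- The matrix of a torus element is the diagonal matrix of its entries (★ `glDiagonal_torusEntry`, ★ `coe_glDiagonal`). [cite: Rogawski1990, §1.10 p. 9] -/
theorem val_coe_eq_diagonal (t : ↥(cmBorelTriple L 3 v).M) :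
    Units.val ((t : ↥(unitaryGroupOfForm (conjLocal L (IsCMField.complexConj L) v) (cmLocalForm L 3 v))) : GL (Fin 3) (LocalRing L v)) =
      Matrix.diagonal fun i => ((torusEntry (conjLocal L (IsCMField.complexConj L) v) (cmLocalForm L 3 v) i t : (LocalRing L v)ˣ) : LocalRing L v) := by
  rw [← glDiagonal_torusEntry L v t]; rfl

/-- **`discr(charpoly t) = ((d₀ − d₁)(d₀ − d₂)(d₁ − d₂))²` and `det t = d₀d₁d₂`** for `t ∈ T` (matrix spelling `(↑t : GL).val` = «HC-BOUNDED»'s at `g = t`).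
[cite: HarishChandra1999AdmissibleDistributions, §17] [cite: Rogawski1990, §4.9 p. 54] -/
theorem discr_charpoly_and_det_torus (w : PlacesOver L v) (t : ↥(cmBorelTriple L 3 v).M) :
    ((t : ↥(unitaryGroupOfForm (conjLocal L (IsCMField.complexConj L) v) (cmLocalForm L 3 v))) : GL (Fin 3) (LocalRing L v)).val.charpoly.discr =
      ((((torusEntry (conjLocal L (IsCMField.complexConj L) v) (cmLocalForm L 3 v) 0 t : (LocalRing L v)ˣ) : LocalRing L v) -
          torusEntry (conjLocal L (IsCMField.complexConj L) v) (cmLocalForm L 3 v) 1 t) *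
        (((torusEntry (conjLocal L (IsCMField.complexConj L) v) (cmLocalForm L 3 v) 0 t : (LocalRing L v)ˣ) : LocalRing L v) -
          torusEntry (conjLocal L (IsCMField.complexConj L) v) (cmLocalForm L 3 v) 2 t) *
        (((torusEntry (conjLocal L (IsCMField.complexConj L) v) (cmLocalForm L 3 v) 1 t : (LocalRing L v)ˣ) : LocalRing L v) -
          torusEntry (conjLocal L (IsCMField.complexConj L) v) (cmLocalForm L 3 v) 2 t)) ^ 2 ∧
    ((t : ↥(unitaryGroupOfForm (conjLocal L (IsCMField.complexConj L) v) (cmLocalForm L 3 v))) : GL (Fin 3) (LocalRing L v)).val.det =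
      ((torusEntry (conjLocal L (IsCMField.complexConj L) v) (cmLocalForm L 3 v) 0 t : (LocalRing L v)ˣ) : LocalRing L v) *
        torusEntry (conjLocal L (IsCMField.complexConj L) v) (cmLocalForm L 3 v) 1 t * torusEntry (conjLocal L (IsCMField.complexConj L) v) (cmLocalForm L 3 v) 2 t := by
  haveI : Nontrivial (LocalRing L v) := ⟨⟨0, 1, fun h01 => zero_ne_one (congrFun h01 w)⟩⟩
  exact discr_charpoly_and_det_of_eq_diagonal _ (fun i => ((torusEntry (conjLocal L (IsCMField.complexConj L) v) (cmLocalForm L 3 v) i t : (LocalRing L v)ˣ) : LocalRing L v))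
    (val_coe_eq_diagonal L v t)

/-! ## §1 The junction `√√‖u‖ = Re Δ(t)`; the HC antecedent ⇔ regular; the adapter -/

section Junction

variable (hns : ∀ w : PlacesOver L v, IsCMField.complexConj L • w.1 = w.1)

/-- **NORM BOOKKEEPING UNDER THE TORUS RELATIONS** `σ(d₂)d₀ = σ(d₁)d₁ = σ(d₀)d₂ = 1` (one place `w ∣ v`): `|d₁|_w = 1`, `|d₀|_w|d₂|_w = 1`, `|d₀ − dᵢ|_w = |d₀|_w|d₀⁻¹dᵢ − 1|_w`,
`|d₁ − d₂|_w = |d₀⁻¹d₁ − 1|_w` (★ (R2a) `sigma_rootA_eq`, `σ` an isometry ★ `normAbs_conjLocal_apply`). [cite: Rogawski1990, §12.2 p. 173; §12.5 p. 182; L. 12.7.2 (proof) p. 193] -/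
theorem normAbs_facts_of_relations (w : PlacesOver L v) (hw : IsCMField.complexConj L • w.1 = w.1) (d : Fin 3 → (LocalRing L v)ˣ)
    (hrel : ∀ i : Fin 3, conjLocal L (IsCMField.complexConj L) v ((d (Fin.rev i) : (LocalRing L v)ˣ) : LocalRing L v) * (d i : LocalRing L v) = 1) :
    normAbs (w.1.adicCompletion L) ((d 1 : LocalRing L v) w) = 1 ∧
    normAbs (w.1.adicCompletion L) ((d 0 : LocalRing L v) w) * normAbs (w.1.adicCompletion L) ((d 2 : LocalRing L v) w) = 1 ∧
    normAbs (w.1.adicCompletion L) ((((d 0 : (LocalRing L v)ˣ) : LocalRing L v) - d 1) w) =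
      normAbs (w.1.adicCompletion L) ((d 0 : LocalRing L v) w) * normAbs (w.1.adicCompletion L) ((((d 0)⁻¹ * d 1 : (LocalRing L v)ˣ) : LocalRing L v) w - 1) ∧
    normAbs (w.1.adicCompletion L) ((((d 0 : (LocalRing L v)ˣ) : LocalRing L v) - d 2) w) =
      normAbs (w.1.adicCompletion L) ((d 0 : LocalRing L v) w) * normAbs (w.1.adicCompletion L) ((((d 0)⁻¹ * d 2 : (LocalRing L v)ˣ) : LocalRing L v) w - 1) ∧
    normAbs (w.1.adicCompletion L) ((((d 1 : (LocalRing L v)ˣ) : LocalRing L v) - d 2) w) =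
      normAbs (w.1.adicCompletion L) ((((d 0)⁻¹ * d 1 : (LocalRing L v)ˣ) : LocalRing L v) w - 1) := by
  have hσ : ∀ x : LocalRing L v, normAbs (w.1.adicCompletion L) (conjLocal L (IsCMField.complexConj L) v x w) = normAbs (w.1.adicCompletion L) (x w) :=
    fun x => F0P3cStCharTSShellWeight.normAbs_conjLocal_apply L v w hw x
  have hinv : ∀ u : (LocalRing L v)ˣ, normAbs (w.1.adicCompletion L) (((u⁻¹ : (LocalRing L v)ˣ) : LocalRing L v) w) =
      (normAbs (w.1.adicCompletion L) ((u : LocalRing L v) w))⁻¹ := fun u => by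
    rw [coe_inv_apply, map_inv₀]
  -- `|d₁|_w = 1` from `σ(d₁) d₁ = 1`
  have h1 : normAbs (w.1.adicCompletion L) ((d 1 : LocalRing L v) w) = 1 := by
    have e := congrArg (fun x : LocalRing L v => normAbs (w.1.adicCompletion L) (x w)) (hrel 1)
    simp only [Pi.mul_apply, map_mul, Pi.one_apply, map_one] at e
    rw [show (Fin.rev (1 : Fin 3)) = 1 from rfl, hσ] at e
    have e' : ((normAbs (w.1.adicCompletion L) ((d 1 : LocalRing L v) w) : ℝ)) * (normAbs (w.1.adicCompletion L) ((d 1 : LocalRing L v) w) : ℝ) = 1 := by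
      exact_mod_cast e
    have hnn : 0 ≤ (normAbs (w.1.adicCompletion L) ((d 1 : LocalRing L v) w) : ℝ) := NNReal.coe_nonneg _
    have h1r : (normAbs (w.1.adicCompletion L) ((d 1 : LocalRing L v) w) : ℝ) = 1 := by nlinarith
    exact_mod_cast h1r
  -- `|d₀|_w |d₂|_w = 1` from `σ(d₀) d₂ = 1`
  have h02 : normAbs (w.1.adicCompletion L) ((d 0 : LocalRing L v) w) * normAbs (w.1.adicCompletion L) ((d 2 : LocalRing L v) w) = 1 := by
    have e := congrArg (fun x : LocalRing L v => normAbs (w.1.adicCompletion L) (x w)) (hrel 2)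
    simp only [Pi.mul_apply, map_mul, Pi.one_apply, map_one] at e
    rw [show (Fin.rev (2 : Fin 3)) = 0 from rfl, hσ] at e
    exact e
  -- `d₀ − dᵢ = −d₀ (d₀⁻¹dᵢ − 1)`
  have hroot : ∀ i : Fin 3, ((d 0 : (LocalRing L v)ˣ) : LocalRing L v) - d i =
      -((d 0 : LocalRing L v) * ((((d 0)⁻¹ * d i : (LocalRing L v)ˣ) : LocalRing L v) - 1)) := fun i => by
    rw [Units.val_mul, mul_sub, mul_one, ← mul_assoc, Units.mul_inv, one_mul]; ring
  have hroot' : ∀ i : Fin 3, normAbs (w.1.adicCompletion L) ((((d 0 : (LocalRing L v)ˣ) : LocalRing L v) - d i) w) =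
      normAbs (w.1.adicCompletion L) ((d 0 : LocalRing L v) w) * normAbs (w.1.adicCompletion L) ((((d 0)⁻¹ * d i : (LocalRing L v)ˣ) : LocalRing L v) w - 1) :=
    fun i => by
    rw [hroot i, Pi.neg_apply, normAbs_neg, Pi.mul_apply, map_mul, Pi.sub_apply, Pi.one_apply]
  -- `|d₁ − d₂|_w = |a − 1|_w`: `d₁ − d₂ = d₂ (d₂⁻¹d₁ − 1)` and `σ(a − 1) = −(d₂ d₁⁻¹)(d₂⁻¹ d₁ − 1)` (★ (R2a))
  have hA : conjLocal L (IsCMField.complexConj L) v ((((d 0)⁻¹ : (LocalRing L v)ˣ) : LocalRing L v) * (d 1 : LocalRing L v) - 1) =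
      -((d 2 : LocalRing L v) * (((d 1)⁻¹ : (LocalRing L v)ˣ) : LocalRing L v)) * ((((d 2)⁻¹ : (LocalRing L v)ˣ) : LocalRing L v) * (d 1 : LocalRing L v) - 1) :=
    F0P3cStCharTSWeylDiscriminant.sigma_rootA_eq (conjLocal L (IsCMField.complexConj L) v) hrel
  have h12 : normAbs (w.1.adicCompletion L) ((((d 1 : (LocalRing L v)ˣ) : LocalRing L v) - d 2) w) =
      normAbs (w.1.adicCompletion L) ((((d 0)⁻¹ * d 1 : (LocalRing L v)ˣ) : LocalRing L v) w - 1) := by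
    have e12 : ((d 1 : (LocalRing L v)ˣ) : LocalRing L v) - d 2 =
        (d 2 : LocalRing L v) * ((((d 2)⁻¹ : (LocalRing L v)ˣ) : LocalRing L v) * (d 1 : LocalRing L v) - 1) := by
      rw [mul_sub, mul_one, ← mul_assoc, Units.mul_inv, one_mul]
    have eA : normAbs (w.1.adicCompletion L) ((((d 0)⁻¹ * d 1 : (LocalRing L v)ˣ) : LocalRing L v) w - 1) =
        normAbs (w.1.adicCompletion L) (conjLocal L (IsCMField.complexConj L) v ((((d 0)⁻¹ : (LocalRing L v)ˣ) : LocalRing L v) * (d 1 : LocalRing L v) - 1) w) := by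
      rw [hσ, Pi.sub_apply, Pi.one_apply, Units.val_mul]
    rw [eA, hA, e12, Pi.mul_apply, map_mul, Pi.mul_apply, Pi.neg_apply, map_mul, normAbs_neg, Pi.mul_apply, map_mul, hinv (d 1), h1, inv_one,
      mul_one]
  exact ⟨h1, h02, hroot' 1, hroot' 2, h12⟩

/-- **THE FOURTH ROOT, abstractly**: under the torus relations, `u · (d₀d₁d₂)^{3−1} = ((d₀−d₁)(d₀−d₂)(d₁−d₂))²` gives `√√|u|_w = |d₀|_w · |a − 1|_w · √|b − 1|_w`
(`|det| = 1`, `|discr| = (|d₀|²|a−1|²|b−1|)²`). [cite: Rogawski1990, §4.9 p. 54; §12.7 L. 12.7.2 (proof) p. 193] [cite: HarishChandra1999AdmissibleDistributions, §17] -/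
theorem sqrt_sqrt_normAbs_eq_of_relations (w : PlacesOver L v) (hw : IsCMField.complexConj L • w.1 = w.1) (d : Fin 3 → (LocalRing L v)ˣ)
    (hrel : ∀ i : Fin 3, conjLocal L (IsCMField.complexConj L) v ((d (Fin.rev i) : (LocalRing L v)ˣ) : LocalRing L v) * (d i : LocalRing L v) = 1)
    (u : (LocalRing L v)ˣ)
    (hu : (u : LocalRing L v) * ((d 0 : LocalRing L v) * d 1 * d 2) ^ (3 - 1) =
      ((((d 0 : (LocalRing L v)ˣ) : LocalRing L v) - d 1) * (((d 0 : (LocalRing L v)ˣ) : LocalRing L v) - d 2) *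
        (((d 1 : (LocalRing L v)ˣ) : LocalRing L v) - d 2)) ^ 2) :
    NNReal.sqrt (NNReal.sqrt (normAbs (w.1.adicCompletion L) ((u : LocalRing L v) w))) =
      normAbs (w.1.adicCompletion L) ((d 0 : LocalRing L v) w) *
        (normAbs (w.1.adicCompletion L) ((((d 0)⁻¹ * d 1 : (LocalRing L v)ˣ) : LocalRing L v) w - 1) *
          NNReal.sqrt (normAbs (w.1.adicCompletion L) ((((d 0)⁻¹ * d 2 : (LocalRing L v)ˣ) : LocalRing L v) w - 1))) := by
  obtain ⟨h1, h02, h01', h02', h12⟩ := normAbs_facts_of_relations L v w hw d hrel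
  have e := congrArg (fun x : LocalRing L v => normAbs (w.1.adicCompletion L) (x w)) hu
  simp only [Pi.mul_apply, Pi.pow_apply, map_mul, map_pow] at e
  rw [h01', h02', h12, h1, mul_one, h02, one_pow, mul_one] at e
  -- `|u_w| = (X²)²` with `X = |d₀| |a−1| √|b−1|`: `X² = |d₀|²|a−1|²|b−1|`
  have hX2 : (normAbs (w.1.adicCompletion L) ((d 0 : LocalRing L v) w) *
        (normAbs (w.1.adicCompletion L) ((((d 0)⁻¹ * d 1 : (LocalRing L v)ˣ) : LocalRing L v) w - 1) *
          NNReal.sqrt (normAbs (w.1.adicCompletion L) ((((d 0)⁻¹ * d 2 : (LocalRing L v)ˣ) : LocalRing L v) w - 1)))) ^ 2 =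
      normAbs (w.1.adicCompletion L) ((d 0 : LocalRing L v) w) * normAbs (w.1.adicCompletion L) ((((d 0)⁻¹ * d 1 : (LocalRing L v)ˣ) : LocalRing L v) w - 1) *
        (normAbs (w.1.adicCompletion L) ((d 0 : LocalRing L v) w) * normAbs (w.1.adicCompletion L) ((((d 0)⁻¹ * d 2 : (LocalRing L v)ˣ) : LocalRing L v) w - 1)) *
        normAbs (w.1.adicCompletion L) ((((d 0)⁻¹ * d 1 : (LocalRing L v)ˣ) : LocalRing L v) w - 1) := by
    rw [mul_pow, mul_pow, NNReal.sq_sqrt]; ring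
  rw [e, ← hX2, NNReal.sqrt_sq, NNReal.sqrt_sq]

include hns in
/-- **THE JUNCTION `√√‖u‖ = Re Δ(t)`**: for `t ∈ T` and ANY unit `u` of `R` with `u · det(t)^{3−1} = discr(charpoly t)` — the antecedent of the named fact «HC-BOUNDED»
`normalizedCharacter_locallyBounded` at `N = 3`, `H = qsForm L`, `g = t` — Harish-Chandra's weight `|D_G(t)|_{L⁺_v}^{1∕2} = √√‖u‖` EQUALS `Re Δ(t)` (★ `unitModulusChar_eq_normAbs`,
§0 torus relations, `sqrt_sqrt_normAbs_eq_of_relations`). [cite: Rogawski1990, §4.9 p. 54; §12.7 L. 12.7.2 (proof) p. 193] [cite: HarishChandra1999AdmissibleDistributions, §16 Thm. 16.3; §17] -/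
theorem coe_sqrt_sqrt_unitModulusChar_eq_vanDijkWeight_re (t : ↥(cmBorelTriple L 3 v).M) (u : (LocalRing L v)ˣ)
    (hu : (u : LocalRing L v) *
        ((t : ↥(unitaryGroupOfForm (conjLocal L (IsCMField.complexConj L) v) (cmLocalForm L 3 v))) : GL (Fin 3) (LocalRing L v)).val.det ^ (3 - 1) =
      ((t : ↥(unitaryGroupOfForm (conjLocal L (IsCMField.complexConj L) v) (cmLocalForm L 3 v))) : GL (Fin 3) (LocalRing L v)).val.charpoly.discr) :
    ((NNReal.sqrt (NNReal.sqrt (unitModulusChar (LocalRing L v) u)) : ℝ≥0) : ℝ) = (vanDijkWeight L v t).re := by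
  obtain ⟨w⟩ : Nonempty (PlacesOver L v) := inferInstance
  have hw := hns w
  obtain ⟨hdisc, hdet⟩ := discr_charpoly_and_det_torus L v w t
  rw [hdisc, hdet] at hu
  rw [vanDijkWeight_re_eq_normAbs L v w hw t, F0P3cStCharTSShellWeight.unitModulusChar_eq_normAbs L v w hw u, NNReal.coe_inj]
  exact sqrt_sqrt_normAbs_eq_of_relations L v w hw (fun i => torusEntry (conjLocal L (IsCMField.complexConj L) v) (cmLocalForm L 3 v) i t)
    (F0P3cStCharTSSurjHeckeLin.torusEntry_relation L v t) u hu

include hns in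
/-- **The HC antecedent is inhabited IFF `t` is regular** (`a − 1`, `b − 1` units): (→) `√√‖u‖ > 0` and the junction; (←) `discr = ((d₀−d₁)(d₀−d₂)(d₁−d₂))²` is a unit
(`isUnit_discr_of_relations`), `det t ∈ Rˣ`, `u := discr · (det²)⁻¹`. [cite: Rogawski1990, §12.5 p. 182; §4.9 p. 54] [cite: HarishChandra1999AdmissibleDistributions, §17] -/
theorem exists_unit_mul_det_sq_eq_discr_iff (t : ↥(cmBorelTriple L 3 v).M) :
    (∃ u : (LocalRing L v)ˣ, (u : LocalRing L v) *
        ((t : ↥(unitaryGroupOfForm (conjLocal L (IsCMField.complexConj L) v) (cmLocalForm L 3 v))) : GL (Fin 3) (LocalRing L v)).val.det ^ (3 - 1) =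
      ((t : ↥(unitaryGroupOfForm (conjLocal L (IsCMField.complexConj L) v) (cmLocalForm L 3 v))) : GL (Fin 3) (LocalRing L v)).val.charpoly.discr) ↔
      IsUnit ((((torusEntry (conjLocal L (IsCMField.complexConj L) v) (cmLocalForm L 3 v) 0 t)⁻¹ *
          torusEntry (conjLocal L (IsCMField.complexConj L) v) (cmLocalForm L 3 v) 1 t : (LocalRing L v)ˣ) : LocalRing L v) - 1) ∧
        IsUnit ((((torusEntry (conjLocal L (IsCMField.complexConj L) v) (cmLocalForm L 3 v) 0 t)⁻¹ *
          torusEntry (conjLocal L (IsCMField.complexConj L) v) (cmLocalForm L 3 v) 2 t : (LocalRing L v)ˣ) : LocalRing L v) - 1) := by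
  obtain ⟨w⟩ : Nonempty (PlacesOver L v) := inferInstance
  have hw := hns w
  constructor
  · rintro ⟨u, hu⟩
    rw [← vanDijkWeight_re_pos_iff L v hns t, ← coe_sqrt_sqrt_unitModulusChar_eq_vanDijkWeight_re L v hns t u hu, NNReal.coe_pos, NNReal.sqrt_pos,
      NNReal.sqrt_pos, pos_iff_ne_zero, F0P3cStCharTSShellWeight.unitModulusChar_eq_normAbs L v w hw u]
    exact F0P3cStCharTSShellWeight.normAbs_apply_ne_zero L v w u
  · rintro ⟨ha, hb⟩
    obtain ⟨hdisc, hdet⟩ := discr_charpoly_and_det_torus L v w t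
    -- the discriminant is a unit (regularity), the determinant is a unit (an element of `GL`)
    have hD : IsUnit (((t : ↥(unitaryGroupOfForm (conjLocal L (IsCMField.complexConj L) v) (cmLocalForm L 3 v))) : GL (Fin 3) (LocalRing L v)).val.charpoly.discr) := by
      rw [hdisc]
      exact isUnit_discr_of_relations (conjLocal L (IsCMField.complexConj L) v)
        (fun i => torusEntry (conjLocal L (IsCMField.complexConj L) v) (cmLocalForm L 3 v) i t) (F0P3cStCharTSSurjHeckeLin.torusEntry_relation L v t) ha hb
    have hdetU : IsUnit (((t : ↥(unitaryGroupOfForm (conjLocal L (IsCMField.complexConj L) v) (cmLocalForm L 3 v))) : GL (Fin 3) (LocalRing L v)).val.det) := by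
      rw [hdet]
      exact ((torusEntry (conjLocal L (IsCMField.complexConj L) v) (cmLocalForm L 3 v) 0 t).isUnit.mul
        (torusEntry (conjLocal L (IsCMField.complexConj L) v) (cmLocalForm L 3 v) 1 t).isUnit).mul
        (torusEntry (conjLocal L (IsCMField.complexConj L) v) (cmLocalForm L 3 v) 2 t).isUnit
    obtain ⟨uD, huD⟩ := hD
    obtain ⟨uP, huP⟩ := hdetU.pow (3 - 1)
    refine ⟨uD * uP⁻¹, ?_⟩
    rw [Units.val_mul, ← huP, mul_assoc, Units.inv_mul, mul_one, huD]

include hns in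
/-- **ADAPTER «HC-BOUNDED ⇒ a bound on `Re Δ · Θ`»**: if on a set `C ∋ t` one has `√√‖u‖ · ‖Θ g‖ ≤ B` for every `g ∈ C` and every unit `u` with `u · det(g)² = discr(charpoly g)`
(the conclusion shape of «HC-BOUNDED» at `N = 3`), then `‖(Re Δ(t) : ℂ) · Θ(t)‖ ≤ max B 0` (regular `t`: the unit of `exists_unit_mul_det_sq_eq_discr_iff` + the junction; else `Δ(t) = 0`).
[cite: Rogawski1990, §12.7 L. 12.7.2 (proof) p. 193; §1.6 p. 6] [cite: HarishChandra1999AdmissibleDistributions, §16 Thm. 16.3] -/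
theorem norm_ofReal_vanDijkWeight_re_mul_le_of_hcBound {Θ : Gqs L v → ℂ} {C : Set (Gqs L v)} {B : ℝ}
    (hB : ∀ g ∈ C, ∀ u : (LocalRing L v)ˣ,
      (u : LocalRing L v) * ((g.val : GL (Fin 3) (LocalRing L v)).val.det) ^ (3 - 1) = ((g.val : GL (Fin 3) (LocalRing L v)).val.charpoly).discr →
        ((NNReal.sqrt (NNReal.sqrt (unitModulusChar (LocalRing L v) u)) : ℝ≥0) : ℝ) * ‖Θ g‖ ≤ B)
    (t : ↥(cmBorelTriple L 3 v).M) (ht : (((t : ↥(unitaryGroupOfForm (conjLocal L (IsCMField.complexConj L) v) (cmLocalForm L 3 v))) : Gqs L v)) ∈ C) :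
    ‖(((vanDijkWeight L v t).re : ℝ) : ℂ) * Θ ((t : ↥(unitaryGroupOfForm (conjLocal L (IsCMField.complexConj L) v) (cmLocalForm L 3 v))) : Gqs L v)‖ ≤ max B 0 := by
  rw [norm_mul, Complex.norm_real, Real.norm_eq_abs, abs_of_nonneg (vanDijkWeight_re_nonneg L v hns t)]
  rcases Classical.em (IsUnit ((((torusEntry (conjLocal L (IsCMField.complexConj L) v) (cmLocalForm L 3 v) 0 t)⁻¹ *
        torusEntry (conjLocal L (IsCMField.complexConj L) v) (cmLocalForm L 3 v) 1 t : (LocalRing L v)ˣ) : LocalRing L v) - 1) ∧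
      IsUnit ((((torusEntry (conjLocal L (IsCMField.complexConj L) v) (cmLocalForm L 3 v) 0 t)⁻¹ *
        torusEntry (conjLocal L (IsCMField.complexConj L) v) (cmLocalForm L 3 v) 2 t : (LocalRing L v)ˣ) : LocalRing L v) - 1)) with hreg | hreg
  · obtain ⟨u, hu⟩ := (exists_unit_mul_det_sq_eq_discr_iff L v hns t).2 hreg
    rw [← coe_sqrt_sqrt_unitModulusChar_eq_vanDijkWeight_re L v hns t u hu]
    exact (hB _ ht u hu).trans (le_max_left _ _)
  · rw [F0P3cStCharTSVanDijkWeylSymm.vanDijkWeight_eq_zero_of_not L v t hreg, Complex.zero_re, zero_mul]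
    exact le_max_right _ _

end Junction

end Summit.HodgeConjecture.HodgeConjecture.Cruxes.H413.F0P3cStCharTSVanDijkHC

end
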